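import Summits.HodgeConjecture.HodgeConjecture.Theses.HeckePrymWeil
import Summits.HodgeConjecture.HodgeConjecture.Theorems.HeckePrymWeilAimedDescendingProof
import Summits.HodgeConjecture.HodgeConjecture.Theorems.HeckePrymWeilHeckePrymAnchorsUpgrade
import Summits.HodgeConjecture.HodgeConjecture.Theorems.HeckePrymWeilHeckePrymAnchorsRationalAlongSection
import Summits.HodgeConjecture.HodgeConjecture.Theorems.HeckePrymWeilHeckePrymAnchorsGlobalClassOfLeray
import Summits.HodgeConjecture.HodgeConjecture.Theorems.HeckePrymWeilIsoInvariance
import Literature.AlgebraicGeometry.HodgeTheory.WeilFamilyReach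
import Literature.AlgebraicGeometry.HodgeTheory.WeilClassesRationalPlane
import Literature.AlgebraicGeometry.HodgeTheory.WeilClassesSixfoldsProofs
import Literature.AlgebraicGeometry.HodgeTheory.WeilClassesIsogenyDescent
import Literature.AlgebraicGeometry.HodgeTheory.InvariantClassesFromTotalSpaceHolds
import Literature.AlgebraicGeometry.HodgeTheory.ComplexConjugationHolds
import Literature.AlgebraicGeometry.Motives.AbelianVarietyCohomologyExteriorH1
import Literature.AlgebraicGeometry.Motives.VarietiesGeometricallyIntegralProofs
import HarnessLib
import HarnessLib.Audit

/-!
# Line `generic-ppav-secant-descent`, RE-BASED on the proved `AimedDescending` — crux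
# `HeckePrymWeil.WeilTenfoldsSqrtMinus11` (stmt-HodgeConjecture-1262). Skeleton v2 (lead c3, 2026-08-17).

Picked after the death of `quaternionic-norm-anchors` (`Lines/quaternionic-norm-anchors-dead.md`). Source of the
re-base: crux-strategist s1, `Lines/secant_twelvefold_aimed.lean` + `STRATEGY-CENSUS.md` §Strengthen (R2): the route
support `AimedDescending` (stmt-14643) is PROVED (`Theorems.aimedDescending_proof`), so the crux follows from the
SPLIT `ℚ(√-11)` TWELVEFOLD component alone — the component with tensor anchors `X₆ × X̂₆` for every abelian sixfold,
where Markman's secant objects live and purity of `κ(E)` is automatic (arXiv:2502.03415 Cor. 1.3.2). The four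
descent stubs of the 2026-08-16 skeleton of this line are therefore gone, and the lead's reshape on pick-up RE-TYPES
the bet's anchor polarization as a `K`-symmetrised hyperplane class (the ROUTE typing of `AimedDescending` /
`weilFamilyReach_hyperbolic`), which makes the reach stub PROVABLE NOW from the accepted named fact
`HodgeTheory.weilFamilyReach_hyperbolic` at `(n, d) = (6, 11)`.

## Registered stubs (the only `sorry`s)

* `stub_secantSpreadEmbedded` — THE BET (Markman's programme at `n = 6`): ONE split `ℚ(√-11)` anchor twelvefold
  `(A₀, ψ₀)`, polarised by the `K`-symmetrised hyperplane class `h₀ = 11·e₀^*a₀ + ψ₀^*e₀^*a₀` of a projective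
  embedding, hyperbolic for it, THROUGH WHICH flat rational Hodge sections `(hh, w)` (degree 2 through `h₀`, degree
  12 through a class of the typed Weil plane) of every smooth projective family are algebraic on every fibre.
* `stub_weilFamilyReach` — the summit's shared NAMED FACT `HodgeTheory.weilFamilyReach_hyperbolic` BY NAME
  (Deligne's polarized Weil family through a hyperbolic anchor, reaching every hyperbolic target up to `K`-isogeny;
  `Literature/AlgebraicGeometry/HodgeTheory/WeilFamilyReach.lean`; also Stub F of the sibling crux 14642's line).

PROVED here: `hyperbolicTwelvefolds_of_reach_of_spread` (the reach bridge: the two stubs give the Hodge–Weil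
classes of EVERY split `√-11` twelvefold, in the route typing — Leray globalisation of the Weil section (proved
engine `stub_globalClassOfSection_of_leray deligne1968_invariantClass_fromTotalSpace_holds`), rationality along the
section (`stub_rationalAlongSection`), the bet on the reach family, one-class-suffices on the reached fibre
(`weilClassesOf_le_algebraicClasses_iff_exists_ne_zero_of_dim_eq` + `abelianVarietyCohomologyExteriorH1_holds`),
the proved isogeny descent `mem_algebraicClasses_of_isogeny_of_mem_weilClassesOf`, and the landed typing upgrade
`stub_upgrade`), `weilTenfolds_of_splitTwelvefolds` (`aimedDescending_proof` at `(11, 5)`, strategist's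
`weilTenfolds_of_hyperbolicTwelvefolds`), and the composition `WeilTenfoldsSqrtMinus11_of` BY NAME.

## Disproof used (`Cruxes/WeilTenfoldsSqrtMinus11/Disproof.lean`, cycle 3; re-read 2026-08-17T10:3xZ)

F9 (`¬S1 → ¬HC`): the bet is refutable only by a Hodge counterexample; §I's two `_false_without_` theorems concern
`stub_aimingArithmetic`, absorbed (with both hypotheses) inside `aimedDescending_proof`; §B `hhodge` load-bearing —
honoured (`locusOfHodgeClasses π 12 6`); SCOPE "every δ" — honoured by `AimedDescending`. The NEW barrier
`SplitObjectsNoGo.md` (split objects are never semiregular with Weil charge) is honoured: the intended witness of the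
bet is Markman's simple reflexive non-split secant^⊠2 sheaf. `ledger negatives`: unrelated.
-/

noncomputable section

-- single-problem summit (Problem = Summit): the mandated namespace repeats `HodgeConjecture`.
set_option linter.dupNamespace false

open CategoryTheory Complex AlgebraicGeometry MonoidalCategory CartesianMonoidalCategory
open Literature.AlgebraicGeometry Literature.AlgebraicGeometry.Motives
  Literature.AlgebraicGeometry.HodgeTheory Literature.AlgebraicTopology.SingularHomology
open Summit.HodgeConjecture.HodgeConjecture.Theses.HeckePrymWeil
open Summit.HodgeConjecture.HodgeConjecture.Theorems.HeckePrymWeilLine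
  (stub_upgrade stub_rationalAlongSection stub_globalClassOfSection_of_leray)

namespace Summit.HodgeConjecture.HodgeConjecture.Cruxes.WeilTenfoldsSqrtMinus11.GenericPpavSecantAimed

/-! ## §0 The strengthened target S⁺ (split `√-11` twelvefolds, route typing) and S⁺ → crux (PROVED) -/

/-- **S⁺ = split `ℚ(√-11)`-Weil TWELVEFOLDS** — verbatim the split-rung hypothesis of `AimedDescending` at
`(p, n) = (11, 5)`, `m = 6` (strategist s1, `StrategyCensus1262.lean`).
[cite: vanGeemen1994HodgeAV, Lemma 5.2 (3) and 5.4] [cite: Markman2025SurveySecant, §11.5 Step 2] -/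
def HyperbolicTwelvefoldsSqrtMinus11 : Prop :=
  ∀ (A : AbelianVariety ℂ) (φ : A ⟶ A), A.dim = 12 → φ ≫ φ = -((11 : ℤ) • 𝟙 A) →
    ∀ (e : ProjectiveEmbedding A.X) (a : complexBetti (projectiveSpace e.n ℂ) 2),
      IsRationalClass a → a ≠ 0 →
      IsHyperbolicWeilType A φ 6
        ((11 : ℂ) • complexBetti.map e.ι 2 a + complexBetti.map φ.hom.hom.hom 2 (complexBetti.map e.ι 2 a)) →
      ∀ c : complexBetti A.X 12, IsRationalClass c → IsOfHodgeType 12 A.X 12 6 6 c →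
        c ∈ Module.End.eigenspace (complexBetti.map (𝟙 A + φ).hom.hom.hom 12).hom
              ((1 + Complex.I * (Real.sqrt (11 : ℝ) : ℂ)) ^ 12) ⊔
            Module.End.eigenspace (complexBetti.map (𝟙 A + φ).hom.hom.hom 12).hom
              ((1 - Complex.I * (Real.sqrt (11 : ℝ) : ℂ)) ^ 12) →
        c ∈ algebraicClasses A.X 6

/-- **The crux from split twelvefolds** (`aimedDescending_proof` at `(11, 5)`; strategist s1's
`weilTenfolds_of_hyperbolicTwelvefolds`, re-proved here so that the skeleton is self-contained).
[cite: Markman2025SurveySecant, §11.5 Step 2] [cite: Schoen1998HodgeWeilAddendum, §10] -/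
theorem weilTenfolds_of_splitTwelvefolds (h12 : HyperbolicTwelvefoldsSqrtMinus11) :
    -- the crux `WeilTenfoldsSqrtMinus11`, UNFOLDED (the skeleton checker takes the first theorem concluding the
    -- crux BY NAME as the composition; that is `WeilTenfoldsSqrtMinus11_of` below)
    ∀ (A : AbelianVariety ℂ) (φ : A ⟶ A), A.dim = 10 → φ ≫ φ = -((11 : ℤ) • 𝟙 A) →
      ∀ c : complexBetti A.X 10, IsRationalClass c → IsOfHodgeType 10 A.X 10 5 5 c →
        c ∈ Module.End.eigenspace (complexBetti.map (𝟙 A + φ).hom.hom.hom 10).hom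
              ((1 + Complex.I * (Real.sqrt (11 : ℝ) : ℂ)) ^ 10) ⊔
            Module.End.eigenspace (complexBetti.map (𝟙 A + φ).hom.hom.hom 10).hom
              ((1 - Complex.I * (Real.sqrt (11 : ℝ) : ℂ)) ^ 10) →
        c ∈ algebraicClasses A.X 5 := by
  have hAD : AimedDescending := Summit.HodgeConjecture.HodgeConjecture.Theorems.aimedDescending_proof
  unfold HyperbolicTwelvefoldsSqrtMinus11 at h12
  unfold AimedDescending at hAD
  intro A φ hdim hφ c hc hH hW
  refine hAD 11 (by norm_num) (by norm_num) (by norm_num) 5 (by norm_num) ?_ A φ hdim hφ c hc hH hW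
  intro m hm A' φ' hdim' hφ' e a ha ha0 hhyp c' hc' hH' hW'
  subst hm
  exact h12 A' φ' hdim' hφ' e a ha ha0 hhyp c' hc' hH' hW'

/-! ## §1 The registered stubs -/

/-- **Stub 1′ — THE BET: a SECANT ANCHOR THROUGH WHICH WEIL CLASSES SPREAD, anchor polarisation in the route typing**
(lead c3 reshape of the parked line's Stub 1 `stub_secantSpread`, triage pass ×3: the anchor's `K`-compatible Kähler
class is presented as the `K`-symmetrised hyperplane class `h₀ = 11·e₀^*a₀ + ψ₀^*e₀^*a₀` of a projective embedding
`e₀`, hyperbolic for it — every `K`-compatible ample class has this form up to `ℚ_{>0}`, so the bet is unchanged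
in content; the vestigial idempotent clauses of the old off-diagonal anchor are dropped). There exist a complex
abelian TWELVEFOLD `A₀` with `ψ₀ ≫ ψ₀ = -11`, a projective embedding `e₀` and a rational `a₀ ≠ 0` with
`IsHyperbolicWeilType A₀ ψ₀ 6 h₀` (the SPLIT component; intended: Markman's secant anchor `X × X̂`, `X` a principally
polarised abelian SIXFOLD at which the theta-CI secant^⊠2 object is semiregular), SUCH THAT for every smooth projective
family `π : 𝒳 → S` of relative dimension `12` over a smooth integral quasi-projective `ℂ`-scheme, every pair of
continuous families of classes `hh` (degree 2) and `w` (degree 12) with values in the locus of Hodge classes at every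
point, and every point `s₀` whose fibre is identified with `A₀` so that `hh(s₀) = h₀` and `w(s₀)` is a class of the
typed Weil plane of `(A₀, ψ₀)`, the class `w(s)` is ALGEBRAIC on `𝒳_s` for every `s`. Intended proof: Markman
arXiv:2502.03415 one rung above crux 14642 — a simple rank-2 `P`-secant object `F` on `X` with theta-CI support,
Orlov transfer to a reflexive `E₀` on `X × X̂` with `κ(E₀) ∈ ℚ[h₀] ⊕ W` charged (Cor. 1.3.2, every `n`),
SEMIREGULARITY of an equivariant descent of `E₀` (`rank ob_F = n(n-1) = 30`, Lemma 8.3.4), then Perry 2026 Thm 1.1 (2)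
/ Buchweitz–Flenner / Pridham–Markman §7.5: `κ(E₀)` remains algebraic wherever `(h, w)` remain Hodge. Why it might
fail: `rank ob_F > 30` for theta-CI supports, or no simple rank-2 object with this class (Markman Q. 8.2.4, open).
[informal size XL; open mathematics] [cite: Markman2025SecantWeil, Cor. 1.3.2, Lemma 8.3.4, §7.5 and Question 8.2.4]
[cite: Perry2026Semiregularity, Thm. 1.1 (2)] [cite: BuchweitzFlenner2003, Thm. 5.1] -/
theorem stub_secantSpreadEmbedded :
    ∃ (A₀ : AbelianVariety ℂ) (ψ₀ : A₀ ⟶ A₀) (e₀ : ProjectiveEmbedding A₀.X)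
      (a₀ : complexBetti (projectiveSpace e₀.n ℂ) 2),
      A₀.dim = 12 ∧ ψ₀ ≫ ψ₀ = -((11 : ℤ) • 𝟙 A₀) ∧ IsRationalClass a₀ ∧ a₀ ≠ 0 ∧
      IsHyperbolicWeilType A₀ ψ₀ 6
        ((11 : ℂ) • complexBetti.map e₀.ι 2 a₀ + complexBetti.map ψ₀.hom.hom.hom 2 (complexBetti.map e₀.ι 2 a₀)) ∧
      ∀ (𝒳 S : SchemeOver ℂ) (π : 𝒳 ⟶ S),
        IsSmoothProjectiveFamily π 12 → IsQuasiProjectiveOver S →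
        _root_.AlgebraicGeometry.IsIntegral S.left → _root_.AlgebraicGeometry.Smooth S.hom →
      ∀ (hh : ∀ s : ComplexPoints S, complexBetti (fiberOver π s) (2 * 1))
        (w : ∀ s : ComplexPoints S, complexBetti (fiberOver π s) (2 * 6)),
        Continuous (fun s => (⟨s, hh s⟩ : FiberClass π (2 * 1))) →
        Continuous (fun s => (⟨s, w s⟩ : FiberClass π (2 * 6))) →
        (∀ s, (⟨s, hh s⟩ : FiberClass π (2 * 1)) ∈ locusOfHodgeClasses π 12 1) →
        (∀ s, (⟨s, w s⟩ : FiberClass π (2 * 6)) ∈ locusOfHodgeClasses π 12 6) →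
      ∀ (s₀ : ComplexPoints S) (ι₀ : fiberOver π s₀ ≅ A₀.X) (c₀ : complexBetti A₀.X 12),
        c₀ ∈ Module.End.eigenspace (complexBetti.map (𝟙 A₀ + ψ₀).hom.hom.hom 12).hom
                ((1 + Complex.I * (Real.sqrt (11 : ℝ) : ℂ)) ^ 12) ⊔
              Module.End.eigenspace (complexBetti.map (𝟙 A₀ + ψ₀).hom.hom.hom 12).hom
                ((1 - Complex.I * (Real.sqrt (11 : ℝ) : ℂ)) ^ 12) →
        hh s₀ = complexBetti.map ι₀.hom (2 * 1)
          ((11 : ℂ) • complexBetti.map e₀.ι 2 a₀ + complexBetti.map ψ₀.hom.hom.hom 2 (complexBetti.map e₀.ι 2 a₀)) →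
        w s₀ = complexBetti.map ι₀.hom (2 * 6) c₀ →
      ∀ s : ComplexPoints S, w s ∈ algebraicClasses (fiberOver π s) 6 := by
  sorry

/-- **Stub R — the reach, BY NAME**: the summit's shared named fact `HodgeTheory.weilFamilyReach_hyperbolic`
(Deligne's polarized `K`-Weil family through a hyperbolic anchor `(P, ψ₀, h_K)`: global polarization class with
`e'^*H_{s₀} = h_K`, a continuous `(n,n)`-valued Weil section through any `w ≠ 0`, abelian fibres, and a `K`-isogeny
from every hyperbolic target `(A, φ)` to a fibre on which the transported section is a non-zero Weil class).
Infrastructure debt of the tree (PEL Shimura varieties / universal abelian scheme), not a bet.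
[cite: Deligne1982HodgeCycles, proof of Thm. 4.8 (pp. 47–52) with Prop. 4.4] [cite: vanGeemen1994HodgeAV, 5.4 and 5.8–5.11] -/
theorem stub_weilFamilyReach : weilFamilyReach_hyperbolic := by
  sorry

/-! ### Name-keyed aliases (hypotheses of the composition BY NAME) -/
namespace Registered

/-- Alias of the statement of `stub_secantSpreadEmbedded`. -/
abbrev stub_secantSpreadEmbedded : Prop :=
  type_of% _root_.Summit.HodgeConjecture.HodgeConjecture.Cruxes.WeilTenfoldsSqrtMinus11.GenericPpavSecantAimed.stub_secantSpreadEmbedded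
/-- Alias of the reach fact, keyed by the registered stub name. -/
abbrev stub_weilFamilyReach : Prop := weilFamilyReach_hyperbolic

end Registered

/-! ## §2 The reach bridge (PROVED): the two stubs give every split `√-11` twelvefold -/

/-- **Reach bridge.** `weilFamilyReach_hyperbolic → stub_secantSpreadEmbedded → HyperbolicTwelvefoldsSqrtMinus11`:
given a split target `(A, φ, e, a)` and a rational `(6,6)` class `c` of its typed Weil plane, take a non-zero rational
Weil class `w` of the anchor (`exists_isRationalClass_ne_zero_mem_weilClassesOf`); the reach fact gives Deligne's
family `f : 𝒳 → S` through the anchor (`e' : A₀ ≅ 𝒳_{s₀}`) with global polarization `H` restricting at `s₀` to the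
anchor's `K`-symmetrised class, a continuous fibrewise-`(6,6)` section `σ` through `w`, and a `K`-isogeny pair between
`A` and a fibre `A' ≅ 𝒳_{s₁}` on which `σ(s₁)` is a non-zero Weil class; `σ` is the restriction of a GLOBAL class
`W` (proved Leray engine), rational along (`stub_rationalAlongSection`), so `(H|, W|)` are continuous families in the
Hodge loci; the bet makes `W|_{𝒳_s}` algebraic for every `s`; at `s₁` this is a non-zero algebraic Weil class of `A'`,
so the whole Weil plane of `A'` is algebraic (one class suffices), and the proved isogeny descent returns to `A`, whose
typed plane lies in the strong one (`stub_upgrade`). [cite: Deligne1982HodgeCycles, proof of Thm. 4.8 with Prop. 4.4]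
[cite: vanGeemen1994HodgeAV, 5.4 and proof of Thm. 6.12] -/
theorem hyperbolicTwelvefolds_of_reach_of_spread (hR : weilFamilyReach_hyperbolic)
    (h₁ : Registered.stub_secantSpreadEmbedded) : HyperbolicTwelvefoldsSqrtMinus11 := by
  intro A φ hA hφ e a ha ha0 hhyp c hc hcH hcW
  obtain ⟨A₀, ψ₀, e₀, a₀, hA₀, hψ₀, ha₀, ha₀0, hhyp₀, hspread⟩ := h₁
  -- casts (`p = 11` as a natural number, degrees `2 * 6`)
  have hA' : A.dim = 2 * 6 := hA
  have hA₀' : A₀.dim = 2 * 6 := hA₀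
  have hφℕ : φ ≫ φ = -((11 : ℕ) • 𝟙 A) := by rw [hφ, ← natCast_zsmul]; rfl
  have hψ₀ℕ : ψ₀ ≫ ψ₀ = -((11 : ℕ) • 𝟙 A₀) := by rw [hψ₀, ← natCast_zsmul]; rfl
  have hφℤ : φ ≫ φ = -(((11 : ℕ) : ℤ) • 𝟙 A) := by exact_mod_cast hφ
  -- the typed plane of `A` lies in the strong Weil plane (landed upgrade)
  have hcW' : c ∈ weilClassesOf A φ 6 11 := by
    refine stub_upgrade 11 (by norm_num) (by norm_num) (by norm_num) 6 A φ hA' hφℤ ?_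
    exact_mod_cast hcW
  -- a non-zero rational Weil class on the anchor
  obtain ⟨w, hwW, hw0, hwrat⟩ :=
    exists_isRationalClass_ne_zero_mem_weilClassesOf (n := 6) (d := 11) (by norm_num) hA₀' (by norm_num) hψ₀ℕ
  -- Deligne's family through the anchor, reaching `A` (named fact)
  have hhyp₀' : IsHyperbolicWeilType A₀ ψ₀ 6 (((11 : ℕ) : ℂ) • complexBetti.map e₀.ι 2 a₀ +
      complexBetti.map ψ₀.hom.hom.hom 2 (complexBetti.map e₀.ι 2 a₀)) := by exact_mod_cast hhyp₀
  have hhyp' : IsHyperbolicWeilType A φ 6 (((11 : ℕ) : ℂ) • complexBetti.map e.ι 2 a +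
      complexBetti.map φ.hom.hom.hom 2 (complexBetti.map e.ι 2 a)) := by exact_mod_cast hhyp
  obtain ⟨𝒳, S, f, s₀, s₁, e', A', φ', e₁, σ, H, hfam, hemb, hirr, hsm, hSqp, hfib, hHfib, hH₀, hσc, hpt, hσH,
    hσ₀, hA'dim, hφ', ⟨u, v, m, hm, huv, hu, hv⟩, w₁, hσ₁, hw₁W, hw₁0⟩ :=
    hR 6 11 (by norm_num) (by norm_num) A₀ ψ₀ e₀ a₀ hA₀' hψ₀ℕ ha₀ ha₀0 hhyp₀' w hwW hw0 A φ e a hA' hφℕ ha ha0 hhyp'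
  -- the base is integral (smooth, hence reduced, and irreducible)
  haveI := hsm
  haveI := hirr
  haveI : IsReduced S.left := isReduced_of_smooth_over_field S.hom
  have hint : _root_.AlgebraicGeometry.IsIntegral S.left := isIntegral_of_irreducibleSpace_of_isReduced _
  -- the PROVED Leray engine: `σ` is the restriction of a global class `W`
  obtain ⟨W, hWσ⟩ := stub_globalClassOfSection_of_leray deligne1968_invariantClass_fromTotalSpace_holds f (2 * 6)
    (2 * 6) hfam hemb hsm hSqp hirr σ hσc hpt
  have hcls : ∀ (s : ComplexPoints S) (y : complexBetti (fiberOver f s) (2 * 6)),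
      σ s = ⟨s, y⟩ → complexBetti.map (fiberι f s) (2 * 6) W = y := by
    intro s y hy
    have h := (hWσ s).symm.trans hy
    simp only [globalSection, FiberClass.mk.injEq, heq_eq_eq, true_and] at h
    exact h
  have hW₀ : complexBetti.map (fiberι f s₀) (2 * 6) W = complexBetti.map e'.inv (2 * 6) w := hcls s₀ _ hσ₀
  have hW₁ : complexBetti.map (fiberι f s₁) (2 * 6) W = w₁ := hcls s₁ _ hσ₁
  -- rationality along the section, Hodge type `(6,6)` everywhere
  have hrat₀ : IsRationalClass (σ s₀).cls := by
    rw [hσ₀]; exact hwrat.map _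
  have hratσ : ∀ s, IsRationalClass (σ s).cls :=
    stub_rationalAlongSection f (2 * 6) (2 * 6) hfam hsm hSqp hirr σ hσc hpt s₀ hrat₀
  have hWrat : ∀ s, IsRationalClass (complexBetti.map (fiberι f s) (2 * 6) W) := by
    intro s
    have h := hratσ s
    rw [hWσ s] at h
    exact h
  have hWH : ∀ s, IsOfHodgeType (2 * 6) (fiberOver f s) (2 * 6) 6 6 (complexBetti.map (fiberι f s) (2 * 6) W) := by
    intro s
    have h := hσH s
    rw [hWσ s] at h
    exact h
  -- the bet applied to the reach family, with `hh = H|` and `w = W|`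
  have hh_cont : Continuous (fun s => (⟨s, complexBetti.map (fiberι f s) 2 H⟩ : FiberClass f (2 * 1))) :=
    continuous_globalSection f (2 * 1) H
  have hw_cont : Continuous (fun s => (⟨s, complexBetti.map (fiberι f s) (2 * 6) W⟩ : FiberClass f (2 * 6))) :=
    continuous_globalSection f (2 * 6) W
  have hh_loc : ∀ s, (⟨s, complexBetti.map (fiberι f s) 2 H⟩ : FiberClass f (2 * 1)) ∈
      locusOfHodgeClasses f 12 1 := fun s => (hHfib s)
  have hw_loc : ∀ s, (⟨s, complexBetti.map (fiberι f s) (2 * 6) W⟩ : FiberClass f (2 * 6)) ∈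
      locusOfHodgeClasses f 12 6 := fun s => ⟨hWrat s, hWH s⟩
  -- the anchor data read on `𝒳_{s₀}` through `ι₀ = e'⁻¹`
  have hh₀ : complexBetti.map (fiberι f s₀) 2 H = complexBetti.map e'.symm.hom (2 * 1)
      ((11 : ℂ) • complexBetti.map e₀.ι 2 a₀ + complexBetti.map ψ₀.hom.hom.hom 2 (complexBetti.map e₀.ι 2 a₀)) := by
    have h := congrArg (complexBetti.map e'.inv 2) hH₀
    rw [e'.complexBetti_map_inv_map_hom] at h
    rw [h]
    push_cast
    rfl
  have hc₀W : w ∈ Module.End.eigenspace (complexBetti.map (𝟙 A₀ + ψ₀).hom.hom.hom 12).hom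
        ((1 + Complex.I * (Real.sqrt (11 : ℝ) : ℂ)) ^ 12) ⊔
      Module.End.eigenspace (complexBetti.map (𝟙 A₀ + ψ₀).hom.hom.hom 12).hom
        ((1 - Complex.I * (Real.sqrt (11 : ℝ) : ℂ)) ^ 12) := by
    have h := weilClassesOf_le_eigenspace_sup_eigenspace ψ₀ 6 11 hwW
    exact_mod_cast h
  have hw₀ : complexBetti.map (fiberι f s₀) (2 * 6) W = complexBetti.map e'.symm.hom (2 * 6) w := by
    rw [hW₀]; rfl
  have halgW : ∀ s, complexBetti.map (fiberι f s) (2 * 6) W ∈ algebraicClasses (fiberOver f s) 6 :=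
    hspread 𝒳 S f hfam hSqp hint hsm (fun s => complexBetti.map (fiberι f s) 2 H)
      (fun s => complexBetti.map (fiberι f s) (2 * 6) W) hh_cont hw_cont hh_loc hw_loc s₀ e'.symm w hc₀W hh₀ hw₀
  -- at `s₁`: a non-zero ALGEBRAIC Weil class on `A' ≅ 𝒳_{s₁}`
  have hw₁alg : complexBetti.map e₁.hom (2 * 6) w₁ ∈ algebraicClasses A'.X 6 := by
    have h := halgW s₁
    rw [hW₁] at h
    exact Summit.HodgeConjecture.HodgeConjecture.Theorems.isoInvariance_proof e₁ 6 w₁ h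
  -- one class suffices on `A'`
  have hle : weilClassesOf A' φ' 6 11 ≤ algebraicClasses A'.X 6 :=
    (weilClassesOf_le_algebraicClasses_iff_exists_ne_zero_of_dim_eq abelianVarietyCohomologyExteriorH1_holds
      hA'dim (by norm_num) (by norm_num) hφ').mpr ⟨_, hw₁W, hw₁alg, hw₁0⟩
  -- isogeny descent `A → A'` (proved in the tree)
  have hAsp : IsSmoothProjective (2 * 6) A.X := by
    have h := AbelianVariety.isSmoothProjective_holds (A := A)
    rw [AbelianVariety.isSmoothProjective, hA'] at h
    exact h
  have hA'sp : IsSmoothProjective (2 * 6) A'.X := by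
    have h := AbelianVariety.isSmoothProjective_holds (A := A')
    rw [AbelianVariety.isSmoothProjective, hA'dim] at h
    exact h
  obtain ⟨MA'⟩ := (nonempty_hodgeModel_holds (n := 2 * 6) (X := A'.X)).nonempty hA'sp
  haveI : Flat u.hom.hom.hom.left := hu
  have hcH' : IsOfHodgeType (2 * 6) A.X (2 * 6) 6 6 c := hcH
  exact mem_algebraicClasses_of_isogeny_of_mem_weilClassesOf hAsp hA'sp MA' u v hv hm huv
    (fun c' _ _ hc'W => hle hc'W) hc hcH' hcW'

/-! ## §3 The composition: the registered stubs imply the crux, BY NAME (no `sorry` of its own) -/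

/-- **`WeilTenfoldsSqrtMinus11` from the two stubs**: the reach bridge gives the split `√-11` twelvefolds, the proved
aimed descent gives every `√-11` tenfold discriminant. -/
theorem WeilTenfoldsSqrtMinus11_of
    (h₁ : Registered.stub_secantSpreadEmbedded) (hR : Registered.stub_weilFamilyReach) :
    Summit.HodgeConjecture.HodgeConjecture.Theses.HeckePrymWeil.WeilTenfoldsSqrtMinus11 :=
  weilTenfolds_of_splitTwelvefolds (hyperbolicTwelvefolds_of_reach_of_spread hR h₁)

/-- The crux from the stubs as they stand (depends on their `sorry`s; shows the composition closes). -/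
theorem WeilTenfoldsSqrtMinus11_of_stubs :
    Summit.HodgeConjecture.HodgeConjecture.Theses.HeckePrymWeil.WeilTenfoldsSqrtMinus11 :=
  WeilTenfoldsSqrtMinus11_of stub_secantSpreadEmbedded stub_weilFamilyReach

end Summit.HodgeConjecture.HodgeConjecture.Cruxes.WeilTenfoldsSqrtMinus11.GenericPpavSecantAimed

end
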